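/-
Copyright (c) 2026 the pub-hodgecm-mathlib formalisation cell (harness21).  Prover seat hodgecm-mathlib-K2E2-p02 (g0), Track B ∕ K2-LIT
(build stream 29), h413 = `stmt-HodgeConjecture-24833`, line `K2_E2_ThetaExhaustionByRigidity`, socket module «AdmRep», file #2 — the payment of
`K2E2ThetaExhaustionByRigidity.AdmRep.sig_K2E2AdmExistsAdmissibleOfEven` TOKEN FOR TOKEN.  2026-09-03.
-/
import Summits.HodgeConjecture.HodgeConjecture.Theorems.F0P2fStubEPE3finGlobalEps     -- ★ `stubE3fin_holds` (classes of a line trivial a.e.), ★ `imagUnitSq_ne_zero'`; re-exports ★ `Liu2021.isAdmissible_epsOf_iff_even`, ★ `Def411WeilCarriers.locF ∕ epsOf`, ★ `imagUnit ∕ imagUnitSq`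
import Literature.NumberTheory.GelbartRogawski1991.Prop311PrintedCML2                  -- ★ `Prop311.embedding_of_isReal_imagUnitSq_neg` (`δ_L² < 0` at every real place of `L⁺`)
import Literature.NumberTheory.Automorphic.ConjugateSelfDualInfinityType               -- ★ `IdeleClassGroup.IsConjugateSymplectic.cmType` ([Liu2021, Def. 4.3] `Φ_μ`)
import HarnessLib

/-!
# h413 ∕ Track B «K2-LIT», line `K2_E2_ThetaExhaustionByRigidity`, unit ADM-REP, file #2: A PARITY-EVEN LINE HAS AN ADMISSIBLE ELEMENT WITH THE
# PRESCRIBED COLLECTION OF LOCAL NORM CLASSES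
# (payment of `Cruxes/H413/Lines/K2_E2_ThetaExhaustionByRigidity_AdmRep.lean :: sig_K2E2AdmExistsAdmissibleOfEven`, statement bytes frozen)

Cell `pub/hodgecm-mathlib`, crux H413 = `stmt-HodgeConjecture-24833`, route of record `HCCMUnconditional`; chair K2-lead (g0), dealer K2E2-plan (g0),
EMIT «SKELETON LANDED K2E2» (REQUESTS l.72395) file #2 `sig_K2E2AdmExistsAdmissibleOfEven` (S) ↦ seat K2E2-p02.
THEOREMS ONLY (no `def`, no `instance`, no `notation`, no named-fact hypothesis, no `sorry`); imports = ★ Theorems ∕ ★ Literature + HarnessLib;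
lane `--supports stmt-HodgeConjecture-24833 --as helper` (count-neutral).

THE STATEMENT (bytes of the socket).  `L` a CM field, `L⁺ = maximalRealSubfield L`, `δ_L = imagUnit L` (purely imaginary, non-zero), `d = imagUnitSq L = δ_L²`
(`L = L⁺(√d)`, `d` totally negative); `μ : C_L →ₜ* S¹` a conjugate-symplectic idèle class character with CM type `Φ_μ = hμ.cmType` ([Liu2021, Def. 4.3]);
`a ∈ (L⁺)ˣ` a hermitian LINE with local norm classes `[a]_v = locF L⁺ d a v ∈ L⁺_vˣ ⧸ N(L_vˣ)` (★ `Def411WeilCarriers.locF`, the Hilbert symbol `(a, d)_v`).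
IF the E3♭-count `#{v : [a]_v ≠ 1} + #{φ ∈ Φ_μ : Im φ((2δ_L)⁻¹) > 0}` is EVEN, THEN there is `e ∈ L` which is `Φ_μ`-ADMISSIBLE in the sense of
[Liu2021, Def. 4.12] (★ `IsAdmissibleElement L Φ_μ e`: `e ≠ 0`, `ē = −e`, `Im φ(e) < 0` for every `φ ∈ Φ_μ`) and whose collection of local norm classes in
the `(2δ_L)⁻¹`-normalisation is that of the line: `epsOf L⁺ d L (2δ_L)⁻¹ e = locF L⁺ d a` (★ `Def411WeilCarriers.epsOf`).

THE PROOF (strategy: INSTANTIATE THE PROVED DICTIONARY «Def. 4.12 ⟺ parity» — O'Meara 71:19 with the real places as parity valve — at the pin's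
normaliser `δ := (2δ_L)⁻¹` and discriminant `d := δ_L²`; no new arithmetic).
(1) `δ = (2δ_L)⁻¹` is purely imaginary and non-zero (★ `complexConj_imagUnit`, ★ `imagUnit_ne_zero`; the idiom of ★ `F0P2fStubEPE3finGlobalEps.stubEP_holds`).
(2) `d = δ_L² ≠ 0` (★ `imagUnitSq_ne_zero'`) and `σ_w(d) < 0` at every real place `w` of `L⁺` (★ `Prop311.embedding_of_isReal_imagUnitSq_neg`).
(3) ★ `Liu2021.isAdmissible_epsOf_iff_even L Φ_μ hδ hδ0 d hd0 hdneg (locF a)` — [Liu2021, Def. 4.12] ⟺ «`{v : ε_v ≠ 1}` finite ∧ the count is even» — read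
    right-to-left; the finiteness conjunct is ★ `stubE3fin_holds L a` (Hilbert reciprocity, O'Meara 71:18: the classes of a GLOBAL `a` are trivial at almost
    every place), the parity conjunct is the hypothesis.
The file does not depend on the sibling socket #1 `sig_K2E2AdmLocFNeOneFinite` (its content is already ★ as `stubE3fin_holds`); it is consumed by the closer
#4 `sig_K2E2AdmRepresentative` together with #3.

* §1 **`admExistsAdmissibleOfEven`** — `sig_K2E2AdmExistsAdmissibleOfEven` TOKEN FOR TOKEN (tie probe
      `example : type_of% @admExistsAdmissibleOfEven = type_of% @K2E2ThetaExhaustionByRigidity.AdmRep.sig_K2E2AdmExistsAdmissibleOfEven := rfl`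
      at home once the socket module is built on stream 29: `K2/K2E2-p02/g0/Probe_K2E2AdmExistsAdmissibleOfEven.lean`).
* §2 `admExistsAdmissibleOfEven_iff` — the same dictionary as an `iff` at the pin (finiteness discharged), for the refuter's non-vacuity box and for #4.

HONEST LABEL.  HC_CM is proved only modulo the 7 printed citations (2 remaining named inputs: hLiu418 = `stmt-HodgeConjecture-24832`, h413 =
`stmt-HodgeConjecture-24833`) until rung 0 closes; this file moves no counter.

## References
* [Liu2021] Y. Liu, *Fourier–Jacobi cycles and arithmetic relative trace formula*, Camb. J. Math. 9 (2021) = arXiv:2102.11518: Def. 4.3, Def. 4.11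
  (l. 2083–2097), Def. 4.12 (l. 2102–2108), Rem. 4.14; App. C l. 4550.
* [Omeara1963] O. T. O'Meara, *Introduction to Quadratic Forms*, Grundlehren 117 (1963): §63B Cor. 63:13a, §65A, §71 Thm. 71:18, Thm. 71:19, Cor. 71:19a.
* [GelbartRogawski1991] S. Gelbart, J. Rogawski, *L-functions and Fourier–Jacobi coefficients for the unitary group U(3)*, Invent. Math. 105 (1991), §3.1
  p. 454 (the purely imaginary unit at the real places).
-/

set_option autoImplicit false
-- the mandated namespace repeats the single-problem summit's segment (`HodgeConjecture.HodgeConjecture`)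
set_option linter.dupNamespace false

noncomputable section

open NumberField NumberField.InfinitePlace IsDedekindDomain
open Literature.NumberTheory Literature.NumberTheory.Automorphic
open Literature.NumberTheory.Automorphic.Liu2021 Literature.NumberTheory.Automorphic.Liu2021.Def411WeilCarriers
open Literature.NumberTheory.Automorphic.IdeleClassGroup
open Literature.NumberTheory.GelbartRogawski1991 Literature.NumberTheory.GelbartRogawski1991.UnitaryDualPair
open Literature.AlgebraicGeometry.Liu2021 (IsAdmissibleElement)
open Summit.HodgeConjecture.HodgeConjecture.Cruxes.H413.F0P2fStubEPE3finGlobalEps (stubE3fin_holds imagUnitSq_ne_zero')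

namespace Summit.HodgeConjecture.HodgeConjecture.Cruxes.H413.K2E2AdmExistsAdmissibleOfEven

/-! ## §0 The pin's normaliser `(2δ_L)⁻¹` -/

/-- `(2δ_L)⁻¹` is purely imaginary: `c((2δ_L)⁻¹) = −(2δ_L)⁻¹` (`c(δ_L) = −δ_L`, ★ `complexConj_imagUnit`). [cite: Liu2021, §4 preamble (l. 1884)] -/
theorem complexConj_twoMulImagUnit_inv (L : Type) [Field L] [NumberField L] [IsCMField L] :
    IsCMField.complexConj L (2 * imagUnit L)⁻¹ = -(2 * imagUnit L)⁻¹ := by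
  rw [map_inv₀, map_mul, map_ofNat, complexConj_imagUnit, mul_neg, inv_neg]

/-- `(2δ_L)⁻¹ ≠ 0` (★ `imagUnit_ne_zero`). [cite: Liu2021, §4 preamble (l. 1884)] -/
theorem twoMulImagUnit_inv_ne_zero (L : Type) [Field L] [NumberField L] [IsCMField L] : (2 * imagUnit L)⁻¹ ≠ 0 :=
  inv_ne_zero (mul_ne_zero two_ne_zero (imagUnit_ne_zero L))

/-! ## §2 The dictionary at the pin, finiteness discharged -/

/-- **[Liu2021, Def. 4.12] ⟺ parity, AT THE PIN** (`δ := (2δ_L)⁻¹`, `d := δ_L²`), with the finiteness guard discharged: for a CM type `Φ` of `L` and a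
line `a ∈ (L⁺)ˣ`, there is a `Φ`-admissible `e ∈ L` with `epsOf L⁺ (δ_L²) L (2δ_L)⁻¹ e = locF a` **iff** `#{v : [a]_v ≠ 1} + #{φ ∈ Φ : Im φ((2δ_L)⁻¹) > 0}` is
even — ★ `isAdmissible_epsOf_iff_even` at `hδ ∕ hδ0 ∕ imagUnitSq_ne_zero' ∕ embedding_of_isReal_imagUnitSq_neg`, the conjunct «`{v : [a]_v ≠ 1}` finite»
being ★ `stubE3fin_holds L a` (Hilbert reciprocity). [cite: Liu2021, Def. 4.12 (l. 2102–2108), Rem. 4.14; App. C l. 4550]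
[cite: Omeara1963, §71 Thm. 71:18, Thm. 71:19, Cor. 71:19a] -/
theorem isAdmissible_epsOf_pin_iff_even (L : Type) [Field L] [NumberField L] [IsCMField L]
    (Φ : Literature.AlgebraicGeometry.Motives.CMType L) (a : (↥(maximalRealSubfield L))ˣ) :
    (∃ e : L, IsAdmissibleElement L Φ.1 e ∧
        epsOf (↥(maximalRealSubfield L)) (imagUnitSq L) L (2 * imagUnit L)⁻¹ e =
          locF (↥(maximalRealSubfield L)) (imagUnitSq L) a) ↔
      Even ({v : HeightOneSpectrum (𝓞 ↥(maximalRealSubfield L)) |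
              locF (↥(maximalRealSubfield L)) (imagUnitSq L) a v ≠ 1}.ncard +
        {φ : L →+* ℂ | φ ∈ Φ.1 ∧ 0 < (φ (2 * imagUnit L)⁻¹).im}.ncard) := by
  rw [isAdmissible_epsOf_iff_even L Φ (complexConj_twoMulImagUnit_inv L) (twoMulImagUnit_inv_ne_zero L) (imagUnitSq L)
    (imagUnitSq_ne_zero' L) (fun w hw => Prop311.embedding_of_isReal_imagUnitSq_neg L ⟨w, hw⟩)
    (locF (↥(maximalRealSubfield L)) (imagUnitSq L) a)]
  exact ⟨fun h => h.2, fun h => ⟨stubE3fin_holds L a, h⟩⟩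

/-! ## §1 The socket, token for token -/

/-- **sig ADM-2 PAID — parity-even ⟹ an admissible element with the prescribed collection** (`sig_K2E2AdmExistsAdmissibleOfEven` TOKEN FOR TOKEN).
For conjugate-symplectic `μ` (CM type `Φ_μ = hμ.cmType`, [Liu2021, Def. 4.3]) and a line `a ∈ (L⁺)ˣ` with EVEN E3♭-count
`#{v : [a]_v ≠ 1} + #{φ ∈ Φ_μ : Im φ((2δ_L)⁻¹) > 0}`, there is `e ∈ L` admissible for `Φ_μ` ([Liu2021, Def. 4.12]) whose collection `epsOf (2δ_L)⁻¹ e` is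
`locF a`: ★ `isAdmissible_epsOf_iff_even`.mpr fed ★ `stubE3fin_holds` (finiteness, O'Meara 71:18) and the hypothesis (parity, O'Meara 71:19).
[cite: Liu2021, Def. 4.12 (l. 2102–2108); Rem. 4.14; App. C l. 4550] [cite: Omeara1963, §71 Thm. 71:18, Thm. 71:19, Cor. 71:19a] -/
theorem admExistsAdmissibleOfEven :
    ∀ (L : Type) [Field L] [NumberField L] [IsCMField L]
      (μ : Literature.NumberTheory.Automorphic.IdeleClassGroup L →ₜ* Circle) (hμ : IsConjugateSymplectic L μ)
      (a : (↥(maximalRealSubfield L))ˣ),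
      Even ({v : HeightOneSpectrum (𝓞 ↥(maximalRealSubfield L)) |
              locF (↥(maximalRealSubfield L)) (imagUnitSq L) a v ≠ 1}.ncard +
        {φ : L →+* ℂ | φ ∈ hμ.cmType.1 ∧ 0 < (φ (2 * imagUnit L)⁻¹).im}.ncard) →
      ∃ e : L, IsAdmissibleElement L hμ.cmType.1 e ∧
        epsOf (↥(maximalRealSubfield L)) (imagUnitSq L) L (2 * imagUnit L)⁻¹ e =
          locF (↥(maximalRealSubfield L)) (imagUnitSq L) a :=
  fun L _ _ _ _ hμ a heven => (isAdmissible_epsOf_pin_iff_even L hμ.cmType a).2 heven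

end Summit.HodgeConjecture.HodgeConjecture.Cruxes.H413.K2E2AdmExistsAdmissibleOfEven

end
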